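import Literature.Geometry.DiscreteGeometry.ContactGraphBoundaryTrace
import HarnessLib

/-!
# The fan of bonds at one disc: angular order, the `2π` identity, tight corners

Topic `Literature/Geometry/DiscreteGeometry` (penny graphs / contact numbers). Local (one-vertex)
lemmas for the proof of **Heitmann–Radin 1980, Theorem (2)(a)** [HeitmannRadin1980, p. 284 and
p. 286]: "For any maximal configuration `C` of `n` disks, `n ≥ 3`: (a) `C_g` has a simple closed
polygonal boundary with vertices on a triangular lattice …". Heitmann–Radin's proof (p. 286: "The
essence of our method for proving part (2) is that inequalities (4) and (6) cannot both be
strict") is an EQUALITY ANALYSIS of Harborth's induction [Harborth1974]; the induction itself is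
in the tree (`HarborthInduction.lean` … `HarborthContactNumberProof.lean`, Euler-free: faces are
replaced by the degree bound `≤ 6` and the face-tracing successor `Harborth.succ`). The equality
analysis needs the structure of the bonds at ONE centre `p` of a hard configuration
`P : Finset ℂ`, which this file supplies, in the vocabulary of `ContactGraphBoundaryTrace.lean`
(`nbrs`, `succ P k p` = the counter-clockwise successor of the neighbour `k` around `p`,
`gapAngle P k p` = the angle of the corner at `p` following `k`, `next` = the face map on darts):

* §1 differences of counter-clockwise angles (`ccwAngle_eq_sub_of_le`, `…_of_lt`);
* §2 the successor in angular coordinates: measured from any direction `u`, the successor of a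
  neighbour `k` is the neighbour of least angle above `k`, or — for the neighbour of greatest
  angle — the neighbour of least angle (`ccwAngle_succ_of_exists_gt`, `succ_of_forall_le`); the
  successor map is a bijection of `nbrs P p` (`succ_injOn`, `image_succ_eq`);
* §3 **the corner angles at `p` sum to `2π`** (`sum_gapAngle`), hence Harborth's (2) at one
  vertex in the sharp form `gap(q) + (deg p - 1) π/3 ≤ 2π`, STRICT as soon as another corner at
  `p` is wider than `π/3` (`gapAngle_add_lt`) — this strictness is Heitmann–Radin's "we get a
  strict inequality from (6)" (p. 286); a corner wider than `π/3` forces `deg p ≤ 5`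
  (`card_nbrs_le_five_of_ne`), which is their "(C_b + 1) ≤ 3n - a - 3 (4̃′)" at one vertex;
* §4 every direction that is not a bond direction lies strictly inside some corner
  (`exists_corner_containing`);
* §5 `ζ = e^{iπ/3}` and **tight corners**: a corner of angle exactly `π/3` closes up into a unit
  triangle traced by the face map, `next³ = id` on it, all three of its corners tight
  (`isPeriodicPt_three_of_tight`, `gapAngle_iterate_eq_of_tight`); so a corner wider than `π/3`
  has only such corners along its face walk (`gapAngle_iterate_ne_of_ne`) — the Euler-free
  substitute for Heitmann–Radin's "nontriangle in `C_g`";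
* §6 **coherence**: if all corners at `p` except possibly the one after `q⋆` are tight, every bond
  direction at `p` is `(succ q⋆ - p) ζ^j` (`exists_pow_eq_of_tight`) — the local form of
  "vertices on a triangular lattice".

Nothing here refers to maximal configurations; the global argument is in
`HeitmannRadinStructure.lean`.
-/

noncomputable section

namespace Literature.Geometry.DiscreteGeometry

namespace Harborth

open Complex Finset
open scoped Real

variable {P : Finset ℂ}

/-! ## §1 Differences of counter-clockwise angles -/

/-- If `v` comes no later than `w` counter-clockwise from `u`, the angle from `v` to `w` is the
difference. [cite: HeitmannRadin1980, (6)] -/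
theorem ccwAngle_eq_sub_of_le {u v w : ℂ} (h : ccwAngle u v ≤ ccwAngle u w) :
    ccwAngle v w = ccwAngle u w - ccwAngle u v := by
  rcases ccwAngle_add_ccwAngle u v w with h1 | h1
  · linarith
  · have := ccwAngle_lt_two_pi v w
    exfalso
    linarith

/-- If `w` comes strictly before `v` counter-clockwise from `u`, the angle from `v` to `w` is the
difference plus a full turn. [cite: HeitmannRadin1980, (6)] -/
theorem ccwAngle_eq_sub_add_of_lt {u v w : ℂ} (h : ccwAngle u w < ccwAngle u v) :
    ccwAngle v w = ccwAngle u w - ccwAngle u v + 2 * π := by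
  rcases ccwAngle_add_ccwAngle u v w with h1 | h1
  · have := ccwAngle_nonneg v w
    exfalso
    linarith
  · linarith

/-- Distinct neighbours of `p` lie at distinct angles from any reference direction `u`.
[cite: HeitmannRadin1980, (6)] -/
theorem eq_of_ccwAngle_eq (u : ℂ) {p k k' : ℂ} (hk : k ∈ nbrs P p) (hk' : k' ∈ nbrs P p)
    (h : ccwAngle u (k - p) = ccwAngle u (k' - p)) : k = k' :=
  eq_of_ccwAngle_eq_zero hk hk' (by rw [ccwAngle_eq_sub_of_le h.le, h, sub_self])

/-- Two distinct neighbours make the degree at least two. [folklore] -/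
private theorem two_le_card_nbrs_of_ne {p k k' : ℂ} (hk : k ∈ nbrs P p) (hk' : k' ∈ nbrs P p)
    (hne : k ≠ k') : 2 ≤ (nbrs P p).card := by
  have hsub : ({k, k'} : Finset ℂ) ⊆ nbrs P p := by
    intro x hx
    rcases Finset.mem_insert.1 hx with rfl | hx
    · exact hk
    · rw [Finset.mem_singleton.1 hx]; exact hk'
  have := Finset.card_le_card hsub
  rwa [Finset.card_pair hne] at this

/-! ## §2 The successor in angular coordinates -/

/-- **The successor is the next neighbour counter-clockwise.** Measure angles at `p` from a
direction `u`. If some neighbour of `p` lies at a larger angle than the neighbour `k`, then so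
does the successor of `k`, the corner after `k` has angle "successor minus `k`", and no neighbour
lies strictly between. [cite: HeitmannRadin1980, (6)] -/
theorem ccwAngle_succ_of_exists_gt (u : ℂ) {p k : ℂ} (hk : k ∈ nbrs P p)
    (h : ∃ k' ∈ nbrs P p, ccwAngle u (k - p) < ccwAngle u (k' - p)) :
    ccwAngle u (k - p) < ccwAngle u (succ P k p - p) ∧
      gapAngle P k p = ccwAngle u (succ P k p - p) - ccwAngle u (k - p) ∧
      ∀ k' ∈ nbrs P p, ccwAngle u (k - p) < ccwAngle u (k' - p) →
        ccwAngle u (succ P k p - p) ≤ ccwAngle u (k' - p) := by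
  obtain ⟨k', hk', hlt⟩ := h
  have hk'k : k' ≠ k := by rintro rfl; exact lt_irrefl _ hlt
  have h2 : 2 ≤ (nbrs P p).card := two_le_card_nbrs_of_ne hk' hk hk'k
  have hs_mem : succ P k p ∈ nbrs P p := succ_mem_nbrs hk
  have hsk : succ P k p ≠ k := succ_ne h2
  -- the corner after `k` is at most the angle up to `k'`
  have hgap_le : gapAngle P k p ≤ ccwAngle u (k' - p) - ccwAngle u (k - p) := by
    have := gapAngle_le_ccwAngle (P := P) hk' hk'k
    rwa [ccwAngle_eq_sub_of_le hlt.le] at this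
  have h2π := ccwAngle_lt_two_pi u (k' - p)
  -- hence the successor lies above `k`
  have key : ccwAngle u (k - p) < ccwAngle u (succ P k p - p) := by
    by_contra hle
    push Not at hle
    rcases hle.lt_or_eq with hlt' | heq
    · have e := ccwAngle_eq_sub_add_of_lt hlt'
      rw [gapAngle] at hgap_le
      have := ccwAngle_nonneg u (succ P k p - p)
      linarith
    · exact hsk (eq_of_ccwAngle_eq u hs_mem hk heq)
  have hform : gapAngle P k p = ccwAngle u (succ P k p - p) - ccwAngle u (k - p) := by
    rw [gapAngle, ccwAngle_eq_sub_of_le key.le]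
  refine ⟨key, hform, fun k'' hk'' hlt'' => ?_⟩
  have hk''k : k'' ≠ k := by rintro rfl; exact lt_irrefl _ hlt''
  have := gapAngle_le_ccwAngle (P := P) hk'' hk''k
  rw [ccwAngle_eq_sub_of_le hlt''.le, hform] at this
  linarith

/-- **The successor of the last neighbour is the first one.** If the neighbour `k` of `p` has the
greatest angle from `u` (and `p` has another neighbour), its successor has the least angle, and
the corner after `k` has angle "successor minus `k` plus `2π`". [cite: HeitmannRadin1980, (6)] -/
theorem succ_of_forall_le (u : ℂ) {p k : ℂ} (hk : k ∈ nbrs P p) (h2 : 2 ≤ (nbrs P p).card)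
    (h : ∀ k' ∈ nbrs P p, ccwAngle u (k' - p) ≤ ccwAngle u (k - p)) :
    (∀ k' ∈ nbrs P p, ccwAngle u (succ P k p - p) ≤ ccwAngle u (k' - p)) ∧
      gapAngle P k p = ccwAngle u (succ P k p - p) - ccwAngle u (k - p) + 2 * π := by
  have hs_mem : succ P k p ∈ nbrs P p := succ_mem_nbrs hk
  have hsk : succ P k p ≠ k := succ_ne h2
  have hlt : ccwAngle u (succ P k p - p) < ccwAngle u (k - p) :=
    lt_of_le_of_ne (h _ hs_mem) fun heq => hsk (eq_of_ccwAngle_eq u hs_mem hk heq)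
  have hform : gapAngle P k p = ccwAngle u (succ P k p - p) - ccwAngle u (k - p) + 2 * π := by
    rw [gapAngle, ccwAngle_eq_sub_add_of_lt hlt]
  refine ⟨fun k' hk' => ?_, hform⟩
  by_cases hk'k : k' = k
  · rw [hk'k]; exact h _ hs_mem
  · have hlt' : ccwAngle u (k' - p) < ccwAngle u (k - p) :=
      lt_of_le_of_ne (h k' hk') fun heq => hk'k (eq_of_ccwAngle_eq u hk' hk heq)
    have := gapAngle_le_ccwAngle (P := P) hk' hk'k
    rw [ccwAngle_eq_sub_add_of_lt hlt', hform] at this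
    linarith

/-- **The successor map is injective on the neighbours of `p`** (two neighbours with a common
successor: the later one would lie in the corner after the earlier one).
[cite: HeitmannRadin1980, (6)] -/
theorem succ_injOn {p : ℂ} (h2 : 2 ≤ (nbrs P p).card) :
    Set.InjOn (fun k => succ P k p) (nbrs P p : Set ℂ) := by
  intro k hk k' hk' h
  have hk := Finset.mem_coe.1 hk
  have hk' := Finset.mem_coe.1 hk'
  simp only at h
  by_contra hne
  set s := succ P k p with hs_def
  have hs_mem : s ∈ nbrs P p := succ_mem_nbrs hk
  have m1 : ccwAngle (k - p) (s - p) ≤ ccwAngle (k - p) (k' - p) :=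
    gapAngle_le_ccwAngle hk' (Ne.symm hne)
  have m2 : ccwAngle (k' - p) (s - p) ≤ ccwAngle (k' - p) (k - p) := by
    have := gapAngle_le_ccwAngle (P := P) (p := p) (q := k') hk hne
    rwa [gapAngle, ← h] at this
  rcases m1.lt_or_eq with hlt | heq
  · have e := ccwAngle_eq_sub_add_of_lt hlt
    have hne0 : ccwAngle (k - p) (k' - p) ≠ 0 := fun h0 => hne (eq_of_ccwAngle_eq_zero hk hk' h0)
    have hrev := ccwAngle_rev hne0
    have h0 : ccwAngle (k - p) (s - p) = 0 := le_antisymm (by linarith) (ccwAngle_nonneg _ _)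
    exact succ_ne h2 (eq_of_ccwAngle_eq_zero hk hs_mem h0).symm
  · have hsk' : s = k' := eq_of_ccwAngle_eq (k - p) hs_mem hk' heq
    exact succ_ne h2 (h.symm.trans hsk')

/-- **The successor map permutes the neighbours of `p`.** [cite: HeitmannRadin1980, (6)] -/
theorem image_succ_eq {p : ℂ} (h2 : 2 ≤ (nbrs P p).card) :
    (nbrs P p).image (fun k => succ P k p) = nbrs P p := by
  classical
  refine Finset.eq_of_subset_of_card_le (Finset.image_subset_iff.2 fun k hk => succ_mem_nbrs hk) ?_
  rw [Finset.card_image_of_injOn (succ_injOn h2)]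

/-! ## §3 The corner angles at a centre sum to `2π` -/

/-- **The corner angles at `p` sum to a full turn**: `∑_{k ∈ nbrs p} gapAngle P k p = 2π` (for a
centre with at least two neighbours). Measured from one neighbour `q`, the corner after `k` spans
from `k` to the next neighbour, except that the corner after the last neighbour wraps around to
`q`; the successor map being a bijection, the sum telescopes. [cite: HeitmannRadin1980, (6)] -/
theorem sum_gapAngle {p : ℂ} (h2 : 2 ≤ (nbrs P p).card) :
    ∑ k ∈ nbrs P p, gapAngle P k p = 2 * π := by
  classical
  obtain ⟨q, hq⟩ : (nbrs P p).Nonempty := Finset.card_pos.1 (by omega)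
  obtain ⟨m, hm, hmax⟩ :=
    Finset.exists_max_image (nbrs P p) (fun k => ccwAngle (q - p) (k - p)) ⟨q, hq⟩
  have hform : ∀ k ∈ nbrs P p, gapAngle P k p =
      (ccwAngle (q - p) (succ P k p - p) - ccwAngle (q - p) (k - p)) +
        if k = m then 2 * π else 0 := by
    intro k hk
    by_cases hkm : k = m
    · rw [if_pos hkm, hkm]
      exact (succ_of_forall_le (q - p) hm h2 hmax).2
    · rw [if_neg hkm, add_zero]
      have hlt : ccwAngle (q - p) (k - p) < ccwAngle (q - p) (m - p) :=
        lt_of_le_of_ne (hmax k hk) fun h => hkm (eq_of_ccwAngle_eq (q - p) hk hm h)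
      exact (ccwAngle_succ_of_exists_gt (q - p) hk ⟨m, hm, hlt⟩).2.1
  rw [Finset.sum_congr rfl hform, Finset.sum_add_distrib, Finset.sum_sub_distrib,
    Finset.sum_ite_eq' (nbrs P p) m, if_pos hm]
  have htel : ∑ k ∈ nbrs P p, ccwAngle (q - p) (succ P k p - p) =
      ∑ k ∈ nbrs P p, ccwAngle (q - p) (k - p) := by
    conv_rhs => rw [← image_succ_eq h2]
    rw [Finset.sum_image (succ_injOn h2)]
  rw [htel]
  ring

/-- **Harborth's (2) at one vertex, sharp form**: `gapAngle P q p + (deg p - 1) π/3 ≤ 2π` — the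
other `deg p - 1` corners at `p` have angle `≥ π/3` each. [cite: HeitmannRadin1980, (6)] -/
theorem gapAngle_add_le (hP : IsHard P) {p q : ℂ} (hq : q ∈ nbrs P p) (h2 : 2 ≤ (nbrs P p).card) :
    gapAngle P q p + (((nbrs P p).card : ℝ) - 1) * (π / 3) ≤ 2 * π := by
  classical
  have hsum := sum_gapAngle (P := P) (p := p) h2
  rw [← Finset.add_sum_erase _ _ hq] at hsum
  have hge : ∑ _k ∈ (nbrs P p).erase q, π / 3 ≤ ∑ k ∈ (nbrs P p).erase q, gapAngle P k p :=
    Finset.sum_le_sum fun k hk => (gapAngle_mem hP (Finset.mem_of_mem_erase hk) h2).1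
  rw [Finset.sum_const, Finset.card_erase_of_mem hq, nsmul_eq_mul,
    Nat.cast_sub (by omega : 1 ≤ (nbrs P p).card)] at hge
  push_cast at hge
  linarith

/-- **Heitmann–Radin's strictness in (6)**: if some OTHER corner at `p` is not tight (its angle
is not `π/3`, hence `> π/3`), then `gapAngle P q p + (deg p - 1) π/3 < 2π` strictly.
[cite: HeitmannRadin1980, p. 286] -/
theorem gapAngle_add_lt (hP : IsHard P) {p q : ℂ} (hq : q ∈ nbrs P p) (h2 : 2 ≤ (nbrs P p).card)
    (hw : ∃ q' ∈ nbrs P p, q' ≠ q ∧ gapAngle P q' p ≠ π / 3) :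
    gapAngle P q p + (((nbrs P p).card : ℝ) - 1) * (π / 3) < 2 * π := by
  classical
  have hsum := sum_gapAngle (P := P) (p := p) h2
  rw [← Finset.add_sum_erase _ _ hq] at hsum
  obtain ⟨q', hq', hq'q, hw⟩ := hw
  have hgt : ∑ _k ∈ (nbrs P p).erase q, π / 3 < ∑ k ∈ (nbrs P p).erase q, gapAngle P k p :=
    Finset.sum_lt_sum (fun k hk => (gapAngle_mem hP (Finset.mem_of_mem_erase hk) h2).1)
      ⟨q', Finset.mem_erase.2 ⟨hq'q, hq'⟩,
        lt_of_le_of_ne (gapAngle_mem hP hq' h2).1 (Ne.symm hw)⟩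
  rw [Finset.sum_const, Finset.card_erase_of_mem hq, nsmul_eq_mul,
    Nat.cast_sub (by omega : 1 ≤ (nbrs P p).card)] at hgt
  push_cast at hgt
  linarith

/-- **A corner wider than `π/3` costs a bond**: if the corner after `q` at `p` is not tight then
`p` has at most five neighbours (Heitmann–Radin's "(4̃′)" at one vertex).
[cite: HeitmannRadin1980, p. 286] -/
theorem card_nbrs_le_five_of_ne (hP : IsHard P) {p q : ℂ} (hq : q ∈ nbrs P p)
    (hw : gapAngle P q p ≠ π / 3) : (nbrs P p).card ≤ 5 := by
  by_cases h2 : 2 ≤ (nbrs P p).card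
  · have hle := gapAngle_add_le hP hq h2
    have hgt : π / 3 < gapAngle P q p := lt_of_le_of_ne (gapAngle_mem hP hq h2).1 (Ne.symm hw)
    have hπ := Real.pi_pos
    have : ((nbrs P p).card : ℝ) < 6 := by nlinarith
    have : (nbrs P p).card < 6 := by exact_mod_cast this
    omega
  · omega

/-! ## §4 Every free direction lies inside a corner -/

/-- **A direction that is not a bond direction at `p` lies strictly inside some corner**: there
is a neighbour `k` with `0 < ccwAngle (k - p) w < gapAngle P k p` (the neighbour immediately
clockwise of `w`). [cite: HeitmannRadin1980, p. 286] -/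
theorem exists_corner_containing {p : ℂ} (h2 : 2 ≤ (nbrs P p).card) {w : ℂ}
    (hw : ∀ k ∈ nbrs P p, ccwAngle (k - p) w ≠ 0) :
    ∃ k ∈ nbrs P p, 0 < ccwAngle (k - p) w ∧ ccwAngle (k - p) w < gapAngle P k p := by
  classical
  have hne : (nbrs P p).Nonempty := Finset.card_pos.1 (by omega)
  -- angles measured from `w`; none is zero
  have hw' : ∀ k ∈ nbrs P p, ccwAngle w (k - p) ≠ 0 := fun k hk h =>
    hw k hk (ccwAngle_eq_zero_iff.2 (ccwAngle_eq_zero_iff.1 h).symm)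
  obtain ⟨m, hm, hmax⟩ := Finset.exists_max_image (nbrs P p) (fun k => ccwAngle w (k - p)) hne
  refine ⟨m, hm, ?_, ?_⟩
  · exact lt_of_le_of_ne (ccwAngle_nonneg _ _) (Ne.symm (hw m hm))
  · have hrev : ccwAngle (m - p) w = 2 * π - ccwAngle w (m - p) := ccwAngle_rev (hw' m hm)
    have hform := (succ_of_forall_le w hm h2 hmax).2
    have hpos : 0 < ccwAngle w (succ P m p - p) :=
      lt_of_le_of_ne (ccwAngle_nonneg _ _) (Ne.symm (hw' _ (succ_mem_nbrs hm)))
    linarith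

/-! ## §5 `ζ = e^{iπ/3}` and tight corners -/

/-- `e^{iπ/3} = ½ + (√3/2) i` (Heitmann–Radin's lattice generator: "the points in the complex plane of
the form `m + n exp(iπ/3)`"). [cite: HeitmannRadin1980, §2 (p. 283)] -/
theorem exp_pi_div_three_mul_I :
    Complex.exp (((π / 3 : ℝ) : ℂ) * I) = ⟨1 / 2, Real.sqrt 3 / 2⟩ := by
  apply Complex.ext
  · rw [exp_ofReal_mul_I_re, Real.cos_pi_div_three]
  · rw [exp_ofReal_mul_I_im, Real.sin_pi_div_three]

/-- `|e^{iπ/3}| = 1`. [cite: HeitmannRadin1980, §2 (p. 283)] -/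
theorem norm_exp_pi_div_three_mul_I : ‖Complex.exp (((π / 3 : ℝ) : ℂ) * I)‖ = 1 :=
  norm_exp_ofReal_mul_I _

/-- `ζ² = ζ - 1` for `ζ = e^{iπ/3}` (the sixth cyclotomic relation `ζ² - ζ + 1 = 0`), so that
`ℤ + ℤζ` is closed under multiplication by `ζ`. [cite: HeitmannRadin1980, §2 (p. 283)] -/
theorem exp_pi_div_three_mul_I_sq :
    Complex.exp (((π / 3 : ℝ) : ℂ) * I) ^ 2 = Complex.exp (((π / 3 : ℝ) : ℂ) * I) - 1 := by
  rw [exp_pi_div_three_mul_I]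
  have h3 : Real.sqrt 3 * Real.sqrt 3 = 3 := Real.mul_self_sqrt (by norm_num)
  apply Complex.ext
  · simp only [sq, mul_re, sub_re, one_re]
    nlinarith
  · simp only [sq, mul_im, sub_im, one_im]
    ring

/-- `ζ³ = -1` for `ζ = e^{iπ/3}`. [cite: HeitmannRadin1980, §2 (p. 283)] -/
theorem exp_pi_div_three_mul_I_pow_three :
    Complex.exp (((π / 3 : ℝ) : ℂ) * I) ^ 3 = -1 := by
  have h := exp_pi_div_three_mul_I_sq
  linear_combination (Complex.exp (((π / 3 : ℝ) : ℂ) * I) + 1) * h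

/-- `ζ⁶ = 1` for `ζ = e^{iπ/3}`. [cite: HeitmannRadin1980, §2 (p. 283)] -/
theorem exp_pi_div_three_mul_I_pow_six :
    Complex.exp (((π / 3 : ℝ) : ℂ) * I) ^ 6 = 1 := by
  rw [show 6 = 3 * 2 by norm_num, pow_mul, exp_pi_div_three_mul_I_pow_three]
  norm_num

/-- `|ζ - 1| = 1` for `ζ = e^{iπ/3}` (the third side of the unit triangle `0, 1, ζ`).
[cite: HeitmannRadin1980, §2 (p. 283)] -/
theorem norm_exp_pi_div_three_mul_I_sub_one :
    ‖Complex.exp (((π / 3 : ℝ) : ℂ) * I) - 1‖ = 1 := by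
  rw [← exp_pi_div_three_mul_I_sq, norm_pow, norm_exp_pi_div_three_mul_I, one_pow]

/-- Every power of `ζ = e^{iπ/3}` is an integer combination `a + b ζ`, i.e. a point of the
triangular lattice `{m + n exp(iπ/3)}`. [cite: HeitmannRadin1980, §2 (p. 283)] -/
theorem exists_exp_pi_div_three_mul_I_pow_eq (j : ℕ) :
    ∃ a b : ℤ, Complex.exp (((π / 3 : ℝ) : ℂ) * I) ^ j =
      (a : ℂ) + (b : ℂ) * Complex.exp (((π / 3 : ℝ) : ℂ) * I) := by
  induction j with
  | zero => exact ⟨1, 0, by simp⟩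
  | succ j ih =>
    obtain ⟨a, b, hab⟩ := ih
    refine ⟨-b, a + b, ?_⟩
    have h := exp_pi_div_three_mul_I_sq
    rw [pow_succ, hab]
    simp only [Int.cast_neg, Int.cast_add]
    linear_combination (b : ℂ) * h

/-- **A tight corner is a rotation by `π/3`**: if the corner after `q` at `p` has angle `π/3`,
then `succ P q p - p = (q - p) ζ`. [cite: HeitmannRadin1980, p. 286] -/
theorem succ_sub_eq_mul_of_tight {p q : ℂ} (hq : q ∈ nbrs P p) (ht : gapAngle P q p = π / 3) :
    succ P q p - p = (q - p) * Complex.exp (((π / 3 : ℝ) : ℂ) * I) := by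
  have := eq_mul_exp_ccwAngle (norm_sub_eq_one_of_mem_nbrs hq)
    (norm_sub_eq_one_of_mem_nbrs (succ_mem_nbrs hq))
  rw [gapAngle] at ht
  rw [ht] at this
  exact this

/-- **A neighbour at `+π/3` is the successor and the corner is tight**: if `a, b` are neighbours
of `c` with `b - c = (a - c) ζ`, then `gapAngle P a c = π/3` and `succ P a c = b`.
[cite: HeitmannRadin1980, p. 286] -/
theorem gapAngle_eq_of_eq_mul (hP : IsHard P) {c a b : ℂ} (ha : a ∈ nbrs P c) (hb : b ∈ nbrs P c)
    (h : b - c = (a - c) * Complex.exp (((π / 3 : ℝ) : ℂ) * I)) :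
    gapAngle P a c = π / 3 ∧ succ P a c = b := by
  have hπ := Real.pi_pos
  have hang : ccwAngle (a - c) (b - c) = π / 3 := by
    rw [h]
    exact ccwAngle_mul_exp (sub_ne_zero_of_mem_nbrs ha) (by positivity) (by linarith)
  have hba : b ≠ a := by
    intro hba
    rw [hba, ccwAngle_self] at hang
    linarith
  have h2 : 2 ≤ (nbrs P c).card := two_le_card_nbrs_of_ne hb ha hba
  have hle : gapAngle P a c ≤ π / 3 := hang ▸ gapAngle_le_ccwAngle hb hba
  have heq : gapAngle P a c = π / 3 := le_antisymm hle (gapAngle_mem hP ha h2).1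
  exact ⟨heq, (eq_succ_of_ccwAngle_eq ha hb (hang.trans heq.symm)).symm⟩

/-- **A tight corner closes into a unit triangle traced by the face map.** If the corner after
`q` at `p ∈ P` is tight and `r = succ P q p`, then `r` touches `q`, the face map runs
`(q, p) ↦ (p, r) ↦ (r, q) ↦ (q, p)`, and the corners at `r` (after `p`) and at `q` (after `r`)
are tight as well. [cite: HeitmannRadin1980, p. 286] -/
theorem next_next_of_tight (hP : IsHard P) {p q : ℂ} (hp : p ∈ P) (hq : q ∈ nbrs P p)
    (ht : gapAngle P q p = π / 3) :
    ‖succ P q p - q‖ = 1 ∧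
      next P (p, succ P q p) = (succ P q p, q) ∧ next P (succ P q p, q) = (q, p) ∧
      gapAngle P p (succ P q p) = π / 3 ∧ gapAngle P (succ P q p) q = π / 3 := by
  set r := succ P q p with hr_def
  set z := Complex.exp (((π / 3 : ℝ) : ℂ) * I) with hz_def
  have hz2 : z ^ 2 = z - 1 := exp_pi_div_three_mul_I_sq
  have hr : r - p = (q - p) * z := succ_sub_eq_mul_of_tight hq ht
  have hr_mem : r ∈ nbrs P p := succ_mem_nbrs hq
  have hqP : q ∈ P := (mem_nbrs.1 hq).1
  have hrP : r ∈ P := (mem_nbrs.1 hr_mem).1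
  -- the third side
  have hrq : ‖r - q‖ = 1 := by
    have e : r - q = (q - p) * (z - 1) := by linear_combination hr
    rw [e, norm_mul, norm_sub_eq_one_of_mem_nbrs hq, hz_def, norm_exp_pi_div_three_mul_I_sub_one,
      one_mul]
  -- neighbours at `r` and at `q`
  have hp_r : p ∈ nbrs P r := mem_nbrs.2 ⟨hp, by rw [norm_sub_rev]; exact norm_sub_eq_one_of_mem_nbrs hr_mem⟩
  have hq_r : q ∈ nbrs P r := mem_nbrs.2 ⟨hqP, by rw [norm_sub_rev]; exact hrq⟩
  have hr_q : r ∈ nbrs P q := mem_nbrs.2 ⟨hrP, hrq⟩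
  have hp_q : p ∈ nbrs P q := mem_nbrs.2 ⟨hp, by rw [norm_sub_rev]; exact norm_sub_eq_one_of_mem_nbrs hq⟩
  -- the corner at `r` after `p`
  have e1 : q - r = (p - r) * z := by linear_combination (z - 1) * hr + (q - p) * hz2
  obtain ⟨ht1, hs1⟩ := gapAngle_eq_of_eq_mul hP hp_r hq_r e1
  -- the corner at `q` after `r`
  have e2 : p - q = (r - q) * z := by linear_combination (-z) * hr - (q - p) * hz2
  obtain ⟨ht2, hs2⟩ := gapAngle_eq_of_eq_mul hP hr_q hp_q e2
  refine ⟨hrq, ?_, ?_, ht1, ht2⟩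
  · simp only [next, hs1]
  · simp only [next, hs2]

/-- **A tight corner has period three under the face map.** [cite: HeitmannRadin1980, p. 286] -/
theorem isPeriodicPt_three_of_tight (hP : IsHard P) {d : ℂ × ℂ} (hd : d ∈ darts P)
    (ht : gapAngle P d.1 d.2 = π / 3) : Function.IsPeriodicPt (next P) 3 d := by
  obtain ⟨q, p⟩ := d
  have hp : p ∈ P := (mem_darts.1 hd).1.2
  have hq : q ∈ nbrs P p := mem_nbrs_of_mk_mem_darts' hd
  obtain ⟨-, h1, h2, -, -⟩ := next_next_of_tight hP hp hq ht
  change (next P)^[3] (q, p) = (q, p)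
  simp only [Function.iterate_succ, Function.iterate_zero, Function.comp_apply, id_eq]
  rw [show next P (q, p) = (p, succ P q p) from rfl, h1, h2]

/-- **All corners along the face walk of a tight corner are tight.** [cite: HeitmannRadin1980, p. 286] -/
theorem gapAngle_iterate_eq_of_tight (hP : IsHard P) {d : ℂ × ℂ} (hd : d ∈ darts P)
    (ht : gapAngle P d.1 d.2 = π / 3) (j : ℕ) :
    gapAngle P ((next P)^[j] d).1 ((next P)^[j] d).2 = π / 3 := by
  have hper := isPeriodicPt_three_of_tight hP hd ht
  rw [← hper.iterate_mod_apply j]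
  obtain ⟨q, p⟩ := d
  have hp : p ∈ P := (mem_darts.1 hd).1.2
  have hq : q ∈ nbrs P p := mem_nbrs_of_mk_mem_darts' hd
  obtain ⟨-, h1, -, ht1, ht2⟩ := next_next_of_tight hP hp hq ht
  have hlt : j % 3 < 3 := Nat.mod_lt _ (by norm_num)
  interval_cases (j % 3)
  · exact ht
  · exact ht1
  · simp only [Function.iterate_succ, Function.iterate_zero, Function.comp_apply, id_eq]
    rw [show next P (q, p) = (p, succ P q p) from rfl, h1]
    exact ht2

/-- **A corner wider than `π/3` has only such corners along its face walk** (else its walk would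
be a tight triangle). This is the Euler-free form of "there is a nontriangle in `C_g`" propagating
along the whole boundary of that face. [cite: HeitmannRadin1980, p. 286] -/
theorem gapAngle_iterate_ne_of_ne (hP : IsHard P) (h2 : ∀ p ∈ P, 2 ≤ (nbrs P p).card)
    {d : ℂ × ℂ} (hd : d ∈ darts P) (hw : gapAngle P d.1 d.2 ≠ π / 3) (j : ℕ) :
    gapAngle P ((next P)^[j] d).1 ((next P)^[j] d).2 ≠ π / 3 := by
  intro ht
  obtain ⟨T, hT, hper⟩ := exists_isPeriodicPt_next h2 hd
  -- `d` is on the walk of the tight corner `next^[j] d`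
  have hback : d = (next P)^[T * (j + 1) - j] ((next P)^[j] d) := by
    rw [← Function.iterate_add_apply, Nat.sub_add_cancel (by nlinarith)]
    exact ((hper.mul_const (j + 1)).eq).symm
  have := gapAngle_iterate_eq_of_tight hP (iterate_next_mem_darts hd j) ht (T * (j + 1) - j)
  rw [← hback] at this
  exact hw this

/-! ## §6 Coherence of the bond directions at a centre with tight corners -/

/-- **Coherence.** If every corner at `p` except possibly the one after the neighbour `q⋆` is
tight, then every bond direction at `p` is `(succ P q⋆ p - p) ζ^j` for some `j`: going
counter-clockwise from `succ q⋆`, each neighbour is the previous one turned by `π/3`.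
[cite: HeitmannRadin1980, Theorem (2)(a)] -/
theorem exists_pow_eq_of_tight {p qs : ℂ} (hqs : qs ∈ nbrs P p)
    (ht : ∀ k ∈ nbrs P p, k ≠ qs → gapAngle P k p = π / 3) :
    ∀ k ∈ nbrs P p, ∃ j : ℕ,
      k - p = (succ P qs p - p) * Complex.exp (((π / 3 : ℝ) : ℂ) * I) ^ j := by
  classical
  set q₁ := succ P qs p with hq₁_def
  have hq₁ : q₁ ∈ nbrs P p := succ_mem_nbrs hqs
  -- angles from `q₁`, and the number of neighbours below a given one
  set θ : ℂ → ℝ := fun k => ccwAngle (q₁ - p) (k - p) with hθ_def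
  set μ : ℂ → ℕ := fun k => ((nbrs P p).filter fun k' => θ k' < θ k).card with hμ_def
  suffices main : ∀ n (k : ℂ), k ∈ nbrs P p → μ k = n →
      ∃ j : ℕ, k - p = (q₁ - p) * Complex.exp (((π / 3 : ℝ) : ℂ) * I) ^ j from
    fun k hk => main _ k hk rfl
  intro n
  induction n using Nat.strong_induction_on with
  | _ n ih =>
  intro k hk hμk
  by_cases hkq : k = q₁
  · exact ⟨0, by rw [hkq, pow_zero, mul_one]⟩
  -- `k` lies strictly above `q₁`
  have hθq₁ : θ q₁ = 0 := ccwAngle_self _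
  have hθk : 0 < θ k := by
    refine lt_of_le_of_ne (ccwAngle_nonneg _ _) fun h => hkq ?_
    exact (eq_of_ccwAngle_eq (q₁ - p) hq₁ hk (hθq₁.trans h)).symm
  -- its predecessor `k⁻`: the highest neighbour below `k`
  set L := (nbrs P p).filter fun k' => θ k' < θ k with hL_def
  have hq₁L : q₁ ∈ L := Finset.mem_filter.2 ⟨hq₁, by rw [hθq₁]; exact hθk⟩
  obtain ⟨km, hkmL, hkm_max⟩ := Finset.exists_max_image L θ ⟨q₁, hq₁L⟩
  obtain ⟨hkm, hkm_lt⟩ := Finset.mem_filter.1 hkmL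
  -- the successor of `k⁻` is `k`
  obtain ⟨hup, hgap, hleast⟩ := ccwAngle_succ_of_exists_gt (q₁ - p) hkm ⟨k, hk, hkm_lt⟩
  have hsucc : succ P km p = k := by
    have hle : θ (succ P km p) ≤ θ k := hleast k hk hkm_lt
    rcases hle.lt_or_eq with hlt | heq
    · exact absurd (hkm_max _ (Finset.mem_filter.2 ⟨succ_mem_nbrs hkm, hlt⟩)) (not_le.2 hup)
    · exact eq_of_ccwAngle_eq (q₁ - p) (succ_mem_nbrs hkm) hk heq
  -- `k⁻ ≠ q⋆` (the successor of `q⋆` is `q₁ ≠ k`), so the corner after `k⁻` is tight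
  have hkm_ne : km ≠ qs := by
    intro h
    rw [h, ← hq₁_def] at hsucc
    exact hkq hsucc.symm
  have hrot := succ_sub_eq_mul_of_tight hkm (ht km hkm hkm_ne)
  rw [hsucc] at hrot
  -- induction
  have hμ_lt : μ km < n := by
    rw [← hμk]
    refine Finset.card_lt_card ⟨fun k' hk' => ?_, Finset.not_subset.2 ⟨km, hkmL, ?_⟩⟩
    · obtain ⟨hk'1, hk'2⟩ := Finset.mem_filter.1 hk'
      exact Finset.mem_filter.2 ⟨hk'1, hk'2.trans hkm_lt⟩
    · intro h
      exact lt_irrefl _ (Finset.mem_filter.1 h).2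
  obtain ⟨j, hj⟩ := ih _ hμ_lt km hkm rfl
  exact ⟨j + 1, by rw [hrot, hj, pow_succ, mul_assoc]⟩

end Harborth

end Literature.Geometry.DiscreteGeometry

end
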